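import Summits.CriticalPhenomena.PercolationContinuityZ3.Theorems.PercAnnulusCrossingIICManyRoots
import HarnessLib

/-!
# Many arms from a finite set cost one arm: `P_p(0 and all of X ↔ ∂ⁱⁿΛ(n)) ∼ ν(X ⊆ C(0)) · π_p(n)` (lane RSW3, p1 gen 18)

builds on p205010 (kernel theorem, internal audit signed; external expert review pending) — used only in the `p_c` corollaries
(`θ(p_c) = 0`, `CSH.percolationContinuity_allDimensions`).

RSW3 lane (LANE 3 `prim-rsw3`), seat `prim-rsw3-p1` (gen 18).  Helper file (`--supports stmt-CriticalPhenomena-4575`);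
no definitions, no sorries.  Memo `run/shared/lean/prim/rsw3/P1-QM.md` §31.9.

The `F = univ` case of `…IICManyRoots`: under (A2)□ at aspect `(s,L)` and `θ(p) = 0`, for every IIC probability measure `ν` and every finite
`X`, **`P_p(0 ↔ ∂ⁱⁿΛ(n), x ↔ ∂ⁱⁿΛ(n) ∀ x ∈ X) / π_p(n) → ν(⋂_{x∈X} {0 ↔ x}) > 0`** (`tendsto_real_arms_div_oneArmProb`): the `(|X|+1)`-arm
event from a fixed finite set of sites costs exactly one arm, with the IIC `|X|`-point function as the constant; equivalently
`P_p(x ↔ ∂ⁱⁿΛ(n) ∀ x ∈ X | 0 ↔ ∂ⁱⁿΛ(n)) → ν(X ⊆ C(0))`.  `…_criticalProbI` (every `d ≥ 2`), `…_Z2` (planar, unconditional).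
References: H. Kesten, PTRF 73 (1986) Thm. (3); D. Basu, A. Sapozhnikov, ECP 22 (2017) Thm. 1.1.
-/

noncomputable section

namespace Summit.CriticalPhenomena.PercolationContinuityZ3.Theorems.Crossing

open MeasureTheory Filter Topology Literature.Probability.Percolation Literature.Probability.LatticeModels
open Literature.Probability.Percolation.DCT16
open Summit.CriticalPhenomena.PercolationContinuityZ3.Theorems.SurfaceTension
open scoped Literature.Probability.Percolation

variable {d : ℕ}

/-- **MANY ARMS COST ONE ARM**: under (A2)□ at aspect `(s,L)` and `θ(p) = 0` (`d ≥ 1`, `p > 0`), for every IIC probability measure `ν` and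
every finite `X`: **`P_p(0 ↔ ∂ⁱⁿΛ(n) and x ↔ ∂ⁱⁿΛ(n) ∀ x ∈ X) / π_p(n) → ν(⋂_X {0 ↔ x})`** (positive by
`iicMeasure_real_biInter_openConn_pos`); since `π_p(n) = P_p(0 ↔ ∂ⁱⁿΛ(n))` this is `P_p(x ↔ ∂ⁱⁿΛ(n) ∀ x ∈ X | 0 ↔ ∂ⁱⁿΛ(n)) → ν(X ⊆ C(0))`.
[cite: Kesten1986, Thm. (3)] [cite: BasuSapozhnikov2017ECP, Thm. 1.1] -/
theorem tendsto_real_arms_div_oneArmProb (hd : 1 ≤ d) (p : unitInterval) (hp : 0 < (p : ℝ))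
    (hθ : theta (zdGraph d) 0 p = 0) {s L : ℕ} (hs : 1 ≤ s) {ϰ : ℝ} (hϰ : 0 < ϰ) (hA2 : SetToSetQuasiMultAspectAt d p s L ϰ)
    {ν : Measure (BondConfig (Site d))} [IsProbabilityMeasure ν]
    (hν : ∀ (F : Finset (Sym2 (Site d))) (E : Set (BondConfig (Site d))), MeasurableSet E → DeterminedBy E ↑F →
      Tendsto (fun n : ℕ => (bondPercolation (zdGraph d) p).real (E ∩ siteToBoundary d n) / oneArmProb d p n)
        atTop (𝓝 (ν.real E))) (X : Finset (Site d)) :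
    Tendsto (fun n : ℕ => (bondPercolation (zdGraph d) p).real (siteToBoundary d n ∩ ⋂ x ∈ X, {ω : BondConfig (Site d) |
        ∃ t ∈ innerBoundary (zdGraph d) (box d n), ω ∈ openConnIn (↑(box d n) : Set (Site d)) x t}) / oneArmProb d p n)
      atTop (𝓝 (ν.real (⋂ x ∈ X, (openConn 0 x : Set (BondConfig (Site d)))))) := by
  have h := tendsto_real_inter_arms_div_oneArmProb hd p hp hθ hs hϰ hA2 hν X (F := Set.univ) ⟨∅, fun _ _ _ => by simp⟩
  simpa only [Set.univ_inter] using h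

/-- **At `p_c(ℤ^d)`** (`d ≥ 2`, (A2)□ at aspect `(s,L)`; `θ(p_c) = 0` is the tree theorem p205010): for every IIC probability measure `ν` and
every finite `X`, `P_{p_c}(0 ↔ ∂ⁱⁿΛ(n), x ↔ ∂ⁱⁿΛ(n) ∀ x ∈ X) / π_{p_c}(n) → ν(⋂_X {0 ↔ x})`. [cite: Kesten1986, Thm. (3)] -/
theorem tendsto_real_arms_div_oneArmProb_criticalProbI (hd : 2 ≤ d) {s L : ℕ} (hs : 1 ≤ s) {ϰ : ℝ} (hϰ : 0 < ϰ)
    (hA2 : SetToSetQuasiMultAspectAt d (criticalProbI d) s L ϰ)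
    {ν : Measure (BondConfig (Site d))} [IsProbabilityMeasure ν]
    (hν : ∀ (F : Finset (Sym2 (Site d))) (E : Set (BondConfig (Site d))), MeasurableSet E → DeterminedBy E ↑F →
      Tendsto (fun n : ℕ => (bondPercolation (zdGraph d) (criticalProbI d)).real (E ∩ siteToBoundary d n) /
        oneArmProb d (criticalProbI d) n) atTop (𝓝 (ν.real E))) (X : Finset (Site d)) :
    Tendsto (fun n : ℕ => (bondPercolation (zdGraph d) (criticalProbI d)).real (siteToBoundary d n ∩ ⋂ x ∈ X, {ω : BondConfig (Site d) |
        ∃ t ∈ innerBoundary (zdGraph d) (box d n), ω ∈ openConnIn (↑(box d n) : Set (Site d)) x t}) /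
      oneArmProb d (criticalProbI d) n) atTop (𝓝 (ν.real (⋂ x ∈ X, (openConn 0 x : Set (BondConfig (Site d)))))) := by
  have hd1 : 1 ≤ d := le_trans (by norm_num) hd
  have hp : 0 < ((criticalProbI d : unitInterval) : ℝ) := by
    rw [coe_criticalProbI]; exact criticalProb_zd_pos d hd1
  exact tendsto_real_arms_div_oneArmProb hd1 _ hp (CSH.percolationContinuity_allDimensions d hd) hs hϰ hA2 hν X

/-- **PLANAR, UNCONDITIONAL** (`p_c(ℤ²) = 1/2`; (A2)□ at aspect `(9,77)` by RSW): for every planar IIC probability measure `ν` and every finite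
`X ⊆ ℤ²`, `P_{p_c}(0 ↔ ∂ⁱⁿΛ(n), x ↔ ∂ⁱⁿΛ(n) ∀ x ∈ X) / π_{p_c}(n) → ν(⋂_X {0 ↔ x})`. [cite: Kesten1986, Thm. (3)] -/
theorem tendsto_real_arms_div_oneArmProb_Z2 {ν : Measure (BondConfig (Site 2))} [IsProbabilityMeasure ν]
    (hν : ∀ (F : Finset (Sym2 (Site 2))) (E : Set (BondConfig (Site 2))), MeasurableSet E → DeterminedBy E ↑F →
      Tendsto (fun n : ℕ => (bondPercolation (zdGraph 2) (criticalProbI 2)).real (E ∩ siteToBoundary 2 n) /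
        oneArmProb 2 (criticalProbI 2) n) atTop (𝓝 (ν.real E))) (X : Finset (Site 2)) :
    Tendsto (fun n : ℕ => (bondPercolation (zdGraph 2) (criticalProbI 2)).real (siteToBoundary 2 n ∩ ⋂ x ∈ X, {ω : BondConfig (Site 2) |
        ∃ t ∈ innerBoundary (zdGraph 2) (box 2 n), ω ∈ openConnIn (↑(box 2 n) : Set (Site 2)) x t}) /
      oneArmProb 2 (criticalProbI 2) n) atTop (𝓝 (ν.real (⋂ x ∈ X, (openConn 0 x : Set (BondConfig (Site 2)))))) := by
  obtain ⟨ϰ, hϰ, hA2⟩ := exists_setToSetQuasiMultAspectAt_two_of_criticalProbI_le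
  exact tendsto_real_arms_div_oneArmProb_criticalProbI (d := 2) le_rfl (s := 9) (L := 77) (by norm_num) hϰ (hA2 _ le_rfl) hν X

end Summit.CriticalPhenomena.PercolationContinuityZ3.Theorems.Crossing

end
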